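import Mathlib
import HarnessLib
import HarnessLib.Audit
import Summits.AnomalousDissipation.Statement
import Literature.Analysis.FluidPDE.StatisticalSolution
import Literature.Analysis.FunctionSpaces.TorusSobolevSpace
import Literature.Analysis.FluidPDE.StatisticalSolutionEnergyEq
import HarnessLib.Audit.Status.Attr

/-!
Route: ForcedSmallScales

DORMANT since 2026-08-24T01:05:32Z (reconciler: no traction for 6.4 d (last activity item-evidence-added at 2026-08-17T14:52:18Z); parked, not closed — `ledger route dormant route-AnomalousDissipation-ForcedSmallScales --off` to reactiv) — unstaffed, not closed; items shared with open routes are served there. `ledger route dormant <id> --off` reactivates.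

# Route ForcedSmallScales — AnomalousDissipation (= Literature.Turb.ZerothLaw); realises idea card
forced-small-scales-h1-coercivity-wad-rung

## Thesis X (words)
It suffices to exhibit ONE smooth steady divergence-free mean-zero force f ≠ 0 on T³ with three
properties:
(C1) f is H¹-COERCIVE: the forced EULER equations admit no stationary statistical solution in the
Foias–Prodi/FMRT class
     (Torus.IsStationaryStatisticalSolution 0 f μ — a Borel probability measure on H = L²_σ with
FINITE MEAN ENSTROPHY, the ν = 0
     generator identity and the shell energy inequality ∫_{e₁≤|u|²<e₂}(f,u)dμ ≥ 0). Finite enstrophy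
is built into the class and H is
     mean-zero, so by Poincaré this says: no ideal fluid of finite enstrophy, steady or statistical,
can carry f forever. Every such
     measure is Onsager-REGULAR (H¹ ⊂ B^{1/3+}_{3,∞}), hence no wild/convex-integration state can be
a dodger; the enemies are Diracs at
     finite-enstrophy steady forced Euler states B(v,v) = f, orbit measures of smooth
(quasi-)periodic forced Euler solutions, and
     genuine inviscid-limit statistics.
(C2) f drives, for viscosities ν_j → 0, global Leray–Hopf solutions u_j whose H-lifts U_j (U_j(t) =
u_j(t) a.e., t ≥ 0) have
     ν-UNIFORMLY, PATHWISE bounded energy ‖U_j(t)‖² ≤ E (turbulent saturation, the honest mean-zero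
form of Correlation's BoundedEnergyFamily).
(C3) RATE RIGIDITY: along every such bounded family of f whose limsup-mean enstrophy ⟨‖∇u_j‖²⟩ =
meanDissipation/ν_j diverges
     (weak anomalous dissipation, WAD: Taylor microscale → 0), the mean dissipation is eventually ≥
ε > 0.
The support statement EnstrophyDichotomy (F1, provable now with the in-tree FMRT Ch. IV machinery:
time-average measures exist and are
stationary statistical solutions — exists_timeAverageMeasure_holds, timeAverage_isStationary_holds —
plus norm-tightness from compact
enstrophy sublevel sets and passage of ν∫(u,ΔΦ')dμ → 0) says: a pathwise-bounded family with BOUNDED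
mean enstrophy along ν_j → 0 leaves
behind a stationary statistical solution of forced Euler. Hence (C1)+(C2)+F1 force WAD along every
bounded family of f — a fixed smooth
stirring at bounded energy must create ever finer scales — and (C3) upgrades WAD to the zeroth law.

## Thesis X (Lean, one line; = item ForcedSmallScalesThesis, elaborated rc 0 in the planner's
Sketch.lean)
∃ f, IsSmooth f ∧ IsDivFree f ∧ HasZeroMean f ∧ f ≠ 0 ∧ (∀ μ, ¬
Torus.IsStationaryStatisticalSolution 0 f μ) ∧
(∃ ν u₀ u U, (∀ j, 0 < ν j) ∧ Tendsto ν atTop (nhds 0) ∧ (∀ j, Torus.IsGlobalLerayHopf (ν j) (fun _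
=> f) (u₀ j) (u j)) ∧
  (∀ j t, 0 ≤ t → ⇑(U j t) =ᵐ[volume] u j t) ∧ ∃ E, ∀ j t, 0 ≤ t → ‖U j t‖² ≤ E) ∧
(∀ ν u₀ u U, … same family clauses … → (∃ E, ∀ j t, 0 ≤ t → ‖U j t‖² ≤ E) → Tendsto (j ↦
meanDissipation (ν j) (u j) / ν j) atTop atTop →
  ∃ ε > 0, ∀ᶠ j in atTop, ε ≤ meanDissipation (ν j) (u j))
All constants exist: Literature.Analysis.FunctionSpaces.Torus.{IsSmooth, IsDivFree, HasZeroMean,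
energySpace},
Literature.Analysis.FluidPDE.Torus.{IsStationaryStatisticalSolution, IsGlobalLerayHopf},
Literature.Analysis.FluidPDE.meanDissipation.

## Assembly (item Assembly): EnstrophyDichotomy → CoerciveForceExists → BoundedFamilyOfCoercive →
RateRigidity → AnomalousDissipation
Take f from C1 and the lifted bounded family from C2. If ⟨‖∇u_j‖²⟩ = meanDissipation(ν_j,u_j)/ν_j
did not tend to ∞, a subsequence has it
≤ Z (Filter.extraction_of_frequently_atTop); the subfamily satisfies every hypothesis of
EnstrophyDichotomy, which returns a stationary
statistical solution of forced Euler — contradicting coercivity. So the family is WAD; RateRigidity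
gives ε > 0 with ε ≤ meanDissipation
eventually (j ≥ N); shift indices; meanEnergy(u_j) = limsup of Cesàro means of ‖U_j(t)‖² ≤ E
(integral_norm_sq_eq_norm_lift_sq, means in
[0,E] so the Real limsup is honest). Pure bookkeeping (≈150 Lean lines).

Rationale: ## Why this line (planner plancard 2026-08-15; sources: card
forced-small-scales-h1-coercivity-wad-rung and its two novelty audits)
Dualise the WEAKEST rung above laminar where Onsager cannot interfere. WAD(f) — mean enstrophy → ∞
at bounded energy, i.e. ε_ν ≫ ν, Taylor
microscale → 0 — is FMRT's cascade condition (doi:10.1016/s0764-4442(01)02008-0) and the standing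
HYPOTHESIS of the exact-law theorems
(arXiv:1803.09695; Novack2024); DNS pessimists still grant it (arXiv:2504.13298: D ~ Re^{-0.05}).
Run the Constantin–Tarfulea–Vicol engine
(ConstantinTarfuleaVicol2013, there 2-D/SQG and forwards) CONTRAPOSITIVELY in 3-D at the H¹ level: a
bounded family that is NOT WAD has norm-tight
time-average statistics (FoiasManleyRosaTemam2001 Ch. IV Thm 3.1/4.2, PROVED in tree) converging to
a finite-enstrophy stationary statistical
solution of forced Euler (item EnstrophyDichotomy, provable). At H¹ the dual object is
Onsager-regular (CheskidovConstantinFriedlanderShvydkoy2008),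
so no admissibility clause, no energy-equality hypothesis and no wild solution enters — the exact
point where the L²-level sibling (card
euler-coercive-force) is stuck. Imported area: ergodic/statistical-solution theory
(Krylov–Bogoliubov via generalized limits, Riesz–Prokhorov
tightness) + Onsager rigidity; physical dictionary: "H¹-coercive force" = "no finite-enstrophy ideal
flow, steady or statistical, carries f".
Planner's correction to the card: F1 is NOT bookkeeping under limsup-MEAN energy bounds (rare tall
energy excursions are compatible with bounded
mean enstrophy and make the inertial term non-uniformly-integrable, leaving a Reynolds-stress defect
at infinity in the limit identity); the
families of this route therefore carry an H-lift with PATHWISE ν-uniform energy bound — the form in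
which the Literature facts are stated.

## Ranked cruxes (decls of Theses/ForcedSmallScales.lean)
#2 CoerciveForceExists — ∃ f ≠ 0 smooth div-free mean-zero with no stationary statistical solution
of forced Euler (the card's F3; the one
   genuinely new question; decidable both ways: dodger constructions vs Liouville/Bernstein-type
rigidity for H¹-supported flux-free measures).
#3 BoundedFamilyOfCoercive — every coercive f drives a pathwise ν-uniformly bounded lifted
Leray–Hopf family (turbulent saturation Re ~ Gr^{1/2}).
#4 RateRigidity — for coercive f, bounded WAD families dissipate at rate ≥ ε > 0 eventually (the
O(1)-vs-o(1) residue of the summit).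
#5 UniversalDodgers (negative side, ≡ ¬#2) — every smooth f is carried by some finite-enstrophy
stationary forced-Euler statistics.
Support: EnstrophyDichotomy (F1, rank 6, PROVE FIRST — ~600–900 lines on TimeAverage*.lean,
RieszRepresentation, isCompact_setOf_eGradNormSq_le,
integral_weight_energyBalance_nonpos, exists_approx_indicator_Ico); KolmogorovForceNotCoercive (card
F5: sin(2πx₁)e₀ admits a dodger —
cellular steady states; tells #2 to use three-component forces); CyclicForceCoercive (#2 for the
explicit force sin(2πx₁)e₀+sin(2πx₂)e₁+sin(2πx₀)e₂).
Target ForcedSmallScalesThesis (rank 0) = X; Assembly (rank 1) = EnstrophyDichotomy → #2 → #3 → #4 →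
AnomalousDissipation (bookkeeping).

## Kill criteria
UniversalDodgers proved (e.g. an H¹-level stationary h-principle, or KAM/steady dodgers for every f)
⇒ close route refuted:#2 (WAD becomes purely
dynamical). #3 refuted for all coercive f ⇒ close. #4 refuted (a bounded WAD family of a coercive f
with ε_j → 0: "weak anomaly is the truth")
⇒ the route still delivers ∃-WAD + exact laws but not the summit: close as exhausted with census,
report the rung. KolmogorovForceNotCoercive
proved does NOT hurt (calibration); CyclicForceCoercive refuted only redirects #2 to other forces.

## Not decomposed yet (depth is earned by splits)
#4's natural split is Correlation's (0201 CorrelationPersistence ∧ 0202 BoundedEnergyEquality)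
restricted to coercive forces — under WAD the
Kármán–Howarth–Monin balance at fixed scale ℓ reads −(5/4)S₃(ℓ)/ℓ → injected WORK, so Novack2024's
4/5-law hands over ε only modulo Leray–Hopf
leakage; not filed now. F2 of the card (FE-SES are work- and flux-free given a cubic H¹ moment) and
the LH-force a.e.-invariance / smooth-f-to-H
glue are lemmas provers attach with --supports. No definition request: "H¹-coercive" and the lifted
bounded family are one-line inline; a
Literature notion `WeakAnomalousDissipationAt f` (turb) may be requested when the exact-law facts
(arXiv:1803.09695, Novack2024) are vendored.
Suggested first computations (refuters, kit): algebraic/Newton search for finite-Fourier-mode steady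
dodgers P(v·∇v) = f for the Kolmogorov and
cyclic forces (the simplest two-wave ansatz k₁=(1,0,0), k₂=(−1,1,0) cannot emit a pure first-shell
mode: killing the (2,−1,0) output kills the
(0,1,0) output — planner's hand computation, one geometry only); DNS of Z_ν·ν at 4 viscosities for
the cyclic force.

Novelty: NOVELTY (planner plancard 2026-08-15; searched: the card's own sweep + two refuter novelty audits
(14-row zbMATH/crossref sweep, grade
new-combination twice), and today `lit frontier AnomalousDissipation --since 2020`, `lit bridges
AnomalousDissipation --cross any`, crossref
queries "stationary statistical solutions Euler inviscid limit enstrophy", "weak anomalous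
dissipation … exact results", "steady incompressible
Euler external force existence three-dimensional torus", "quasi-periodic forced Euler"; local
searchd and OpenAlex were down/429).
Nearest prior art: arXiv:1305.7089 = ConstantinTarfuleaVicol2013 (stationary-statistical-solution
inviscid limits proving ABSENCE of anomaly
in 2-D/SQG where enstrophy-type bounds are a priori; same engine doi:10.1007/s00220-024-05088-2,
Wagner 2024, p-enstrophy, 2-D damped);
doi:10.1016/s0764-4442(01)02008-0 (Foias–Manley–Rosa–Temam CRAS 2001: energy cascade for forced 3-D
NS statistical solutions exactly when the
Taylor wavenumber² = Z/E → ∞, i.e. WAD is their cascade CONDITION, assumed not derived);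
arXiv:1803.09695 and Novack2024
(doi:10.1088/1361-6544/ad6057): 4/5- and 4/3-laws PROVED under WAD as hypothesis;
FoiasManleyRosaTemam2001 Ch. IV Thm 3.1/4.2 (time-average
measures are stationary statistical solutions — in tree and proved); hub card euler-coercive-force
(L²-level coercivity for the FULL anomaly,
needs energy equality/admissibility, threatened by doi:10.1137/140957354 wild steady states).
Enemies of C1 located: doi:10.101  [refs: 10.1007/s00220-024-05088-2, 10.1016/s0764-4442(01, 10.1088/1361-6544/ad6057, 10.1137/140957354, 10.1016/j.aim.2021.107730, 10.1007/s11401-009-0092-7, 10.1007/s00039-019-00516-1, 10.1051/cocv/2009017, 1305.7089, 1803.09695, doi:10.1007/s00220-024-05088-2, doi:10.1016/s0764-4442, doi:10.1088/1361-6544/ad6057, doi:10.1137/140957354, doi:10.1016/j.aim.2021.107730, doi:10.1007/s11401-009-0092-7, doi:10]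

Barriers (technique_class: stationary-statistical-solutions vanishing-viscosity-limit): BARRIERS (catalogue Literature/Barriers/AnomalousDissipation, 18 index entries examined 2026-08-15;
technique_class: stationary-statistical-solutions vanishing-viscosity-limit; also in play:
finite-enstrophy rigidity, compactness, long-time averages).
- Literature.Barriers.AnomalousDissipation.Cheskidov2023_thm21_noDissipationAnomaly: [euler-limit
vanishing-viscosity-limit compactness] NOT met — it kills inferences "the vanishing-viscosity limit
is a weak Euler solution violating the energy balance ⇒ the family dissipates anomalously"; here the
inviscid limit object is used only in the CONTRAPOSITIVE and only at FINITE ENSTROPHY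
(EnstrophyDichotomy: a bounded, NON-WAD family leaves a finite-enstrophy stationary Euler
statistics), where the limit is Onsager-regular and no energy defect is read off; no anomaly is ever
inferred from a property of a limit.
- Literature.Barriers.AnomalousDissipation.Cheskidov2023_thm13_not_forceRobustNoAnomaly:
[energy-method long-time-averages force-robust] bites ONLY the negative item UniversalDodgers read
as a no-WAD tool and any refutation of RateRigidity/CoerciveForceExists by estimates stable under
C(ℝ;L²)-perturbation of f (Thm 1.3 realises bounded energy + dissipation ≥ ε with ν-dependent
time-periodic f_j → f, which are WAD a fortiori); evaded structurally: a dodger is a stationary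
statistical solution of forced Euler with the EXACT steady f in its generator identity, an object
that does not survive perturbing f; the positive items are ex

Novelty grade: new-combination — ROUTE REVIEW + grade (refuter, 2026-08-15). new-combination: the Constantin–Tarfulea–Vicol stationary-statistical-solution inviscid-limit engine (2-D/SQG, forwards) run CONTRAPOSITIVELY in 3-D at the H¹ level (FMRT Ch. IV time-average measures, in tree) + the new auxiliary notion 'H¹-coercive force' (refuter refuter-rreview-route-NavierStokesRegula-ab1e3435-0, 2026-08-15T11:22:53Z; prior: ConstantinTarfuleaVicol2013 arXiv:1305.7089, FoiasManleyRosaTemam2001 Ch. IV Thm 3.1/4.2, Foias–Manley–Rosa–Temam CRAS 2001 doi:10.1016/s0764-4442(01)02008-0, Novack2024 doi:10.1088/1361-6544/ad6057, arXiv:1803.09695 (exact laws under WAD), CheskidovConstantinFriedlanderShvydkoy2008, Cheskidov2023 arXiv:2311.04182, doi:10.1137/140957354 (wild steady states))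

History (route lifecycle, newest last):
- 2026-08-24T01:05:32Z · DORMANT — reconciler: no traction for 6.4 d (last activity item-evidence-added at 2026-08-17T14:52:18Z); parked, not closed — `ledger route dormant route-AnomalousDissipa (operator:999:295780)

sub-problem: AnomalousDissipation · status: dormant · opened planner-plancard-AnomalousDissipation-Anomalo-5e216124-0 2026-08-15T10:56:07Z · rev 4 · ledger route-AnomalousDissipation-ForcedSmallScales
GENERATED by the gate from the ledger (D-0016/17). Provers cite these decls: `theorem foo : Summit.AnomalousDissipation.AnomalousDissipation.Theses.ForcedSmallScales.<Decl> := …` in Summits/AnomalousDissipation/AnomalousDissipation/Theorems/<Name>.lean.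
-/

namespace Summit.AnomalousDissipation.AnomalousDissipation.Theses.ForcedSmallScales

open scoped BigOperators Topology Manifold Classical MeasureTheory ProbabilityTheory Matrix InnerProductSpace ComplexConjugate ContinuousMap
open Filter Set Function TopologicalSpace MeasureTheory

attribute [summit_statement] _root_.AnomalousDissipation

open Literature.Turb

/-- item stmt-AnomalousDissipation-1433 · target · rank 0 · open · by planner
why it might fail: Conjunction of cruxes #2–#4: dodgers may exist for every f (¬#2); no ν-uniform (let alone pathwise) energy bound is known for any fixed 3-D force (#3); the upgrade WAD ⇒ ε ≥ ε₀ is the quantitative core of the summit, false in 2-D and doubted by recent DNS (#4).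
sources: arXiv:1305.7089, doi:10.1016/s0764-4442(01)02008-0, Novack2024, arXiv:1803.09695, arXiv:2504.13298, FoiasManleyRosaTemam2001 Ch. IV Def. 1.2, Thm 3.1, Thm 4.2
[target] Thesis X of route ForcedSmallScales (card forced-small-scales-h1-coercivity-wad-rung):
there is a smooth steady div-free mean-zero f ≠ 0 on T³ which (C1) is H¹-COERCIVE — no stationary
statistical solution of the forced EULER equations in the FMRT class
Torus.IsStationaryStatisticalSolution 0 f μ (finite mean enstrophy built in; H mean-zero, so no
energy level is needed), (C2) drives a vanishing-viscosity family of global Leray–Hopf solutions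
with H-lifts U j t (= u j t a.e., t ≥ 0) of ν-uniformly PATHWISE bounded energy, and (C3) obeys rate
rigidity: every such bounded family with meanDissipation/ν_j → ∞ (weak anomalous dissipation =
Taylor microscale → 0) has meanDissipation ≥ ε > 0 eventually. Implied by CoerciveForceExists ∧
BoundedFamilyOfCoercive ∧ RateRigidity (instantiate the ∀-cruxes at the f of C1); with
EnstrophyDichotomy it implies AnomalousDissipation exactly as in item Assembly. -/
@[route_item "route-AnomalousDissipation-ForcedSmallScales"]
def ForcedSmallScalesThesis : Prop :=
  ∃ f : UnitAddTorus (Fin 3) → EuclideanSpace ℝ (Fin 3), Literature.Analysis.FunctionSpaces.Torus.IsSmooth f ∧ Literature.Analysis.FunctionSpaces.Torus.IsDivFree f ∧ Literature.Analysis.FunctionSpaces.Torus.HasZeroMean f ∧ f ≠ 0 ∧ (∀ μ : MeasureTheory.Measure (Literature.Analysis.FunctionSpaces.Torus.energySpace (Fin 3)), ¬ Literature.Analysis.FluidPDE.Torus.IsStationaryStatisticalSolution 0 f μ) ∧ (∃ (ν : ℕ → ℝ) (u₀ : ℕ → UnitAddTorus (Fin 3) → EuclideanSpace ℝ (Fin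 3)) (u : ℕ → ℝ → UnitAddTorus (Fin 3) → EuclideanSpace ℝ (Fin 3)) (U : ℕ → ℝ → Literature.Analysis.FunctionSpaces.Torus.energySpace (Fin 3)), (∀ j, 0 < ν j) ∧ Filter.Tendsto ν Filter.atTop (nhds 0) ∧ (∀ j, Literature.Analysis.FluidPDE.Torus.IsGlobalLerayHopf (ν j) (fun _ => f) (u₀ j) (u j)) ∧ (∀ j t, 0 ≤ t → ((U j t : MeasureTheory.Lp (EuclideanSpace ℝ (Fin 3)) 2 (MeasureTheory.volume : MeasureTheory.Measure (UnitAddTorus (Fin 3)))) : UnitAddTorus (Fin 3) → EuclideanSpace ℝ (Fin 3)) =ᵐ[MeasureTheory.volume] u j t) ∧ ∃ E : ℝ, ∀ j t, 0 ≤ t → ‖U j t‖ ^ 2 ≤ E) ∧ (∀ (ν : ℕ → ℝ) (u₀ : ℕ → UnitAddTorus (Fin 3) → EuclideanSpace ℝ (Fin 3)) (u : ℕ → ℝ → UnitAddTorus (Fin 3) → EuclideanSpace ℝ (Fin 3)) (U : ℕ → ℝ → Literature.Analysis.FunctionSpaces.Torus.energySpace (Fin 3)), (∀ j, 0 < ν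 j) → Filter.Tendsto ν Filter.atTop (nhds 0) → (∀ j, Literature.Analysis.FluidPDE.Torus.IsGlobalLerayHopf (ν j) (fun _ => f) (u₀ j) (u j)) → (∀ j t, 0 ≤ t → ((U j t : MeasureTheory.Lp (EuclideanSpace ℝ (Fin 3)) 2 (MeasureTheory.volume : MeasureTheory.Measure (UnitAddTorus (Fin 3)))) : UnitAddTorus (Fin 3) → EuclideanSpace ℝ (Fin 3)) =ᵐ[MeasureTheory.volume] u j t) → (∃ E : ℝ, ∀ j t, 0 ≤ t → ‖U j t‖ ^ 2 ≤ E) → Filter.Tendsto (fun j => Literature.Analysis.FluidPDE.meanDissipation (ν j) (u j) / ν j) Filter.atTop Filter.atTop → ∃ ε : ℝ, 0 < ε ∧ ∀ᶠ j in Filter.atTop, ε ≤ Literature.Analysis.FluidPDE.meanDissipation (ν j) (u j))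

/-- item stmt-AnomalousDissipation-1434 · crux · rank 2 · open · by planner
why it might fail: Finite-enstrophy dodgers may exist for EVERY smooth f: Diracs at steady forced-Euler states B(v,v)=f (cellular 2½-D states for planar f; Nash–Moser near Beltrami flows), orbit measures of quasi-periodic forced Euler (Baldi–Montalto, designer f); nothing classifies H¹ stationary Euler statistics.
sources: doi:10.1016/j.aim.2021.107730, arXiv:1305.7089, doi:10.1137/140957354, doi:10.1007/s11401-009-0092-7, doi:10.1051/cocv/2009017, FoiasManleyRosaTemam2001 Ch. IV Def. 1.2 and Remark (Dirac measures at steady states)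
[crux] C1 = the card's F3, the one genuinely new question. ∃ f smooth div-free mean-zero, f ≠ 0,
such that NO Borel probability measure on H = Torus.energySpace (Fin 3) is a stationary statistical
solution of forced Euler with force f (Torus.IsStationaryStatisticalSolution at ν = 0: finite mean
enstrophy, generator identity ∫[(f,Φ'(u)) + ∫(u⊗u):∇Φ'(u)]dμ = 0 for cylindrical Φ, shell inequality
∫_{e₁≤|u|²<e₂}(f,u)dμ ≥ 0). Enemies (finite-enstrophy, hence Onsager-regular): Dirac at a steady v ∈
V with B(v,v) = f, orbit measures of smooth (quasi-)periodic forced Euler solutions, inviscid limits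
of bounded non-WAD NS statistics. Bet: a genuinely three-component force with trivial symmetry
stabiliser (item CyclicForceCoercive) is coercive; planar rank-1 forces are expected NOT to be (item
KolmogorovForceNotCoercive). Tools: the infinitely many LINEAR constraints on μ (zero mean flux
through every shell K ≥ k_f by CCFS locality, momentum balance ∫u⊗u dμ : ∇ψ = −(f,ψ), shell
positivity) against finite enstrophy (mean stress R ∈ W^{1,1}) — a Liouville/Bernstein-type rigidity
for H¹-supported flux-free measures; negative side: Nash–Moser or finite-mode steady dodgers. -/
@[route_item "route-AnomalousDissipation-ForcedSmallScales", crux]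
def CoerciveForceExists : Prop :=
  ∃ f : UnitAddTorus (Fin 3) → EuclideanSpace ℝ (Fin 3), Literature.Analysis.FunctionSpaces.Torus.IsSmooth f ∧ Literature.Analysis.FunctionSpaces.Torus.IsDivFree f ∧ Literature.Analysis.FunctionSpaces.Torus.HasZeroMean f ∧ f ≠ 0 ∧ ∀ μ : MeasureTheory.Measure (Literature.Analysis.FunctionSpaces.Torus.energySpace (Fin 3)), ¬ Literature.Analysis.FluidPDE.Torus.IsStationaryStatisticalSolution 0 f μ

/-- item stmt-AnomalousDissipation-1435 · crux · rank 3 · open · by planner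
why it might fail: No ν-uniform energy bound is known for ANY fixed f ≠ 0 in 3-D (a priori |u|² ≤ |f|²/(ν²λ₁²) only, FMRT (A.41)); pathwise uniformity is stronger than the mean form of Correlation 0203; a coercive f might still laminarise every Leray–Hopf family (energy ∝ ν^{-a}).
sources: FoiasManleyRosaTemam2001 (13.10)–(13.11) p.105, (A.41) p.115, DoeringFoias2002 §3, Cheskidov2023 §1.2 p.4 (arXiv:2311.04182), Literature.Barriers.AnomalousDissipation.Marchioro1986_globalAttraction, ChildressKerswellGilbert2001 §6 (critical-layer steady branches, energy ∝ G^{1/6}), stmt-AnomalousDissipation-0203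
[crux] C2: for every H¹-coercive smooth div-free mean-zero f ≠ 0 there are ν_j > 0, ν_j → 0, data u₀
j, global Leray–Hopf solutions u j of NS_{ν_j} forced by f, and H-valued lifts U j : ℝ →
Torus.energySpace (Fin 3) with ⇑(U j t) = u j t a.e. for t ≥ 0 (so the slices are mean-zero and
weakly div-free — drift excluded, as the card requires) and a PATHWISE ν-uniform energy bound ‖U j
t‖² ≤ E for all j and t ≥ 0. This is Correlation's BoundedEnergyFamily
(stmt-AnomalousDissipation-0203) in the honest mean-zero form and strengthened from limsup-mean to
pathwise (needed by EnstrophyDichotomy: mean bounds leave a Reynolds-stress defect at infinity); the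
constructor may restart a family at a later time to absorb transients. Physically: turbulent
saturation Re ~ Gr^{1/2} instead of laminar Re ~ Gr (DoeringFoias2002 §3). The hypothesis 'coercive'
is what makes the item composable with C1; it is not expected to help the proof, except that it
rules out the planar/gravest-mode forces whose zero-start families are exactly laminar (energy ∝
ν⁻², weak–strong uniqueness). -/
@[route_item "route-AnomalousDissipation-ForcedSmallScales", crux]
def BoundedFamilyOfCoercive : Prop :=
  ∀ f : UnitAddTorus (Fin 3) → EuclideanSpace ℝ (Fin 3), Literature.Analysis.FunctionSpaces.Torus.IsSmooth f → Literature.Analysis.FunctionSpaces.Torus.IsDivFree f → Literature.Analysis.FunctionSpaces.Torus.HasZeroMean f → f ≠ 0 → (∀ μ : MeasureTheory.Measure (Literature.Analysis.FunctionSpaces.Torus.energySpace (Fin 3)), ¬ Literature.Analysis.FluidPDE.Torus.IsStationaryStatisticalSolution 0 f μ) → ∃ (ν : ℕ → ℝ) (u₀ : ℕ → UnitAddTorus (Fin 3) → EuclideanSpace ℝ (Fin 3)) (u : ℕ → ℝ → UnitAddTorus (Fin 3) → EuclideanSpace ℝ (Fin 3)) (U : ℕ → ℝ → Literature.Analysis.FunctionSpaces.Torus.energySpace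 (Fin 3)), (∀ j, 0 < ν j) ∧ Filter.Tendsto ν Filter.atTop (nhds 0) ∧ (∀ j, Literature.Analysis.FluidPDE.Torus.IsGlobalLerayHopf (ν j) (fun _ => f) (u₀ j) (u j)) ∧ (∀ j t, 0 ≤ t → ((U j t : MeasureTheory.Lp (EuclideanSpace ℝ (Fin 3)) 2 (MeasureTheory.volume : MeasureTheory.Measure (UnitAddTorus (Fin 3)))) : UnitAddTorus (Fin 3) → EuclideanSpace ℝ (Fin 3)) =ᵐ[MeasureTheory.volume] u j t) ∧ ∃ E : ℝ, ∀ j t, 0 ≤ t → ‖U j t‖ ^ 2 ≤ E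

/-- item stmt-AnomalousDissipation-1436 · crux · rank 4 · open · by planner
why it might fail: It is the O(1)-vs-o(1) core of the summit: the 2-D analogue is FALSE (WAD holds with ε ~ ν^{1/2}: AlexakisDoering2006); fixed-force 3-D DNS is read as D ~ Re^{-0.05} → 0 (arXiv:2504.13298); lower bounds on ν⟨‖∇u‖²⟩ for Leray–Hopf families also face leakage (FMRT p.71).
sources: Literature.Barriers.AnomalousDissipation.AlexakisDoering2006_energyDissipationBound, arXiv:2504.13298, KanedaEtAl2003, Frisch1995 §5.2, FoiasManleyRosaTemam2001 p.71 and Ch. V (5.22), Novack2024 (doi:10.1088/1361-6544/ad6057)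
[crux] C3, the residual rung-to-summit upgrade: for every H¹-coercive smooth div-free mean-zero f
and every lifted, pathwise ν-uniformly bounded global Leray–Hopf family (ν_j → 0) whose limsup-mean
enstrophy meanDissipation(ν_j,u_j)/ν_j tends to ∞ (weak anomalous dissipation: Taylor microscale
λ_T² = ν E/ε → 0, FMRT's cascade condition), the mean dissipation is eventually bounded below: ∃ ε >
0, ∀ᶠ j, ε ≤ meanDissipation (ν j) (u j). 'Once a fixed stirring is forced to create ever finer
scales, it dissipates at an O(1) rate.' The WAD hypothesis is what C1+C2+EnstrophyDichotomy deliver;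
the coercivity hypothesis keeps the item composable and excludes planar dodging forces. Expected
later split (tenure): Correlation's CorrelationPersistence (0201) ∧ BoundedEnergyEquality (0202)
restricted to coercive forces — under WAD the KHM balance at fixed scale ℓ gives −(5/4)S₃(ℓ)/ℓ →
injected work (Novack2024-type exact law), so ε follows modulo Leray–Hopf leakage. -/
@[route_item "route-AnomalousDissipation-ForcedSmallScales", crux]
def RateRigidity : Prop :=
  ∀ f : UnitAddTorus (Fin 3) → EuclideanSpace ℝ (Fin 3), Literature.Analysis.FunctionSpaces.Torus.IsSmooth f → Literature.Analysis.FunctionSpaces.Torus.IsDivFree f → Literature.Analysis.FunctionSpaces.Torus.HasZeroMean f → (∀ μ : MeasureTheory.Measure (Literature.Analysis.FunctionSpaces.Torus.energySpace (Fin 3)), ¬ Literature.Analysis.FluidPDE.Torus.IsStationaryStatisticalSolution 0 f μ) → ∀ (ν : ℕ → ℝ) (u₀ : ℕ → UnitAddTorus (Fin 3) → EuclideanSpace ℝ (Fin 3)) (u : ℕ → ℝ → UnitAddTorus (Fin 3) → EuclideanSpace ℝ (Fin 3)) (U : ℕ → ℝ → Literature.Analysis.FunctionSpaces.Torus.energySpace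 (Fin 3)), (∀ j, 0 < ν j) → Filter.Tendsto ν Filter.atTop (nhds 0) → (∀ j, Literature.Analysis.FluidPDE.Torus.IsGlobalLerayHopf (ν j) (fun _ => f) (u₀ j) (u j)) → (∀ j t, 0 ≤ t → ((U j t : MeasureTheory.Lp (EuclideanSpace ℝ (Fin 3)) 2 (MeasureTheory.volume : MeasureTheory.Measure (UnitAddTorus (Fin 3)))) : UnitAddTorus (Fin 3) → EuclideanSpace ℝ (Fin 3)) =ᵐ[MeasureTheory.volume] u j t) → (∃ E : ℝ, ∀ j t, 0 ≤ t → ‖U j t‖ ^ 2 ≤ E) → Filter.Tendsto (fun j => Literature.Analysis.FluidPDE.meanDissipation (ν j) (u j) / ν j) Filter.atTop Filter.atTop → ∃ ε : ℝ, 0 < ε ∧ ∀ᶠ j in Filter.atTop, ε ≤ Literature.Analysis.FluidPDE.meanDissipation (ν j) (u j)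

/-- item stmt-AnomalousDissipation-1437 · crux · rank 5 · open · by planner
why it might fail: Expected FALSE for generic three-component f (= crux #2): steady dodgers solve P(v·∇v)=f, v ∈ H¹, generically obstructed by small divisors of the linearised operator; h-principle steady states are L^∞-wild, far below H¹; no finite-enstrophy invariant measures of forced Euler are known.
sources: doi:10.1137/140957354, doi:10.1016/j.aim.2021.107730, arXiv:1305.7089, CheskidovConstantinFriedlanderShvydkoy2008 Thm 1.1, Literature.Barriers.AnomalousDissipation.Cheskidov2023_thm13_not_forceRobustNoAnomaly, doi:10.1007/s00039-019-00516-1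
[crux, negative side] Equivalent to ¬CoerciveForceExists (f = 0 is carried by δ₀): every smooth
div-free mean-zero force on T³ is carried forever by SOME finite-enstrophy stationary statistical
solution of the forced Euler equations (Torus.IsStationaryStatisticalSolution 0 f μ). A proof is a
universal CONSTRUCTION — steady (Dirac at v ∈ V with B(v,v) = f: a transport/small-divisor problem
along streamlines, cf. the cellular states of KolmogorovForceNotCoercive), time-dependent (KAM tori
/ periodic orbits of forced Euler at finite enstrophy) or statistical (an invariant-measure
construction for forced Euler carried by H¹ — unknown) — and would close the route (WAD becomes
purely dynamical). Staff with refuters/constructors; the force-robust barrier (Cheskidov2023 Thm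
1.3) bites any attempt to derive it from estimates stable in f. -/
@[route_item "route-AnomalousDissipation-ForcedSmallScales"]
def UniversalDodgers : Prop :=
  ∀ f : UnitAddTorus (Fin 3) → EuclideanSpace ℝ (Fin 3), Literature.Analysis.FunctionSpaces.Torus.IsSmooth f → Literature.Analysis.FunctionSpaces.Torus.IsDivFree f → Literature.Analysis.FunctionSpaces.Torus.HasZeroMean f → ∃ μ : MeasureTheory.Measure (Literature.Analysis.FunctionSpaces.Torus.energySpace (Fin 3)), Literature.Analysis.FluidPDE.Torus.IsStationaryStatisticalSolution 0 f μ

/-- item stmt-AnomalousDissipation-1438 · support · rank 6 · open · by planner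
sources: FoiasManleyRosaTemam2001 Ch. IV Thm 3.1, Thm 4.2, §3.1 (3.2)–(3.4), arXiv:1305.7089 §§4–7, Literature.Analysis.FluidPDE.exists_timeAverageMeasure (proved: exists_timeAverageMeasure_holds), Literature.Analysis.FluidPDE.timeAverage_isStationary (proved: timeAverage_isStationary_holds), Literature.Analysis.FluidPDE.Torus.IsTimeAverageMeasure.integral_weight_energyBalance_nonpos, doi:10.1007/s00220-024-05088-2
[support, PROVE FIRST — the route's engine; card F1 corrected] Pathwise-bounded lifted LH family
with bounded mean enstrophy along ν_j → 0 ⇒ a stationary statistical solution of forced Euler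
exists. Plan (~600–900 lines, in-tree tools): (1) smooth f ↦ its H-class
(smoothSolenoidal_subset_energySpace; LH invariant under a.e. change of force); time-average
measures μ_j (exists_timeAverageMeasure_holds), stationary at ν_j (timeAverage_isStationary_holds),
carried by the ball ‖u‖² ≤ E (measure_compl_eq_zero), ∫eGradNormSq dμ_j ≤ Z+1
(integral_le_of_forall_timeMean_le + Fatou); (2) L(g) := generalized limit of ∫g dμ_j: positive,
normalised, tight (isCompact_setOf_eGradNormSq_le) ⇒ L = ∫·dμ
(RieszRepresentation.exists_probabilityMeasure_of_isTightFunctional), μ(ball) = 1, finite enstrophy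
by Fatou; (3) ν = 0 generator identity: its integrand is bounded continuous on the ball;
ν_j∫(u,ΔΦ')dμ_j = O(ν_j√E) → 0; (4) shell inequality: integral_weight_energyBalance_nonpos at ν_j,
weights through L, exists_approx_indicator_Ico + DCT. Support, not crux: known-type compactness (CTV
2013, FMRT IV §3); the pathwise bound removes the one subtlety (uniform integrability). -/
@[route_item "route-AnomalousDissipation-ForcedSmallScales", crux]
def EnstrophyDichotomy : Prop :=
  ∀ f : UnitAddTorus (Fin 3) → EuclideanSpace ℝ (Fin 3), Literature.Analysis.FunctionSpaces.Torus.IsSmooth f → Literature.Analysis.FunctionSpaces.Torus.IsDivFree f → Literature.Analysis.FunctionSpaces.Torus.HasZeroMean f → ∀ (ν : ℕ → ℝ) (u₀ : ℕ → UnitAddTorus (Fin 3) → EuclideanSpace ℝ (Fin 3)) (u : ℕ → ℝ → UnitAddTorus (Fin 3) → EuclideanSpace ℝ (Fin 3)) (U : ℕ → ℝ → Literature.Analysis.FunctionSpaces.Torus.energySpace (Fin 3)), (∀ j, 0 < ν j) → Filter.Tendsto ν Filter.atTop (nhds 0) → (∀ j, Literature.Analysis.FluidPDE.Torus.IsGlobalLerayHopf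 (ν j) (fun _ => f) (u₀ j) (u j)) → (∀ j t, 0 ≤ t → ((U j t : MeasureTheory.Lp (EuclideanSpace ℝ (Fin 3)) 2 (MeasureTheory.volume : MeasureTheory.Measure (UnitAddTorus (Fin 3)))) : UnitAddTorus (Fin 3) → EuclideanSpace ℝ (Fin 3)) =ᵐ[MeasureTheory.volume] u j t) → (∃ E : ℝ, ∀ j t, 0 ≤ t → ‖U j t‖ ^ 2 ≤ E) → (∃ Z : ℝ, ∀ j, Literature.Analysis.FluidPDE.meanDissipation (ν j) (u j) ≤ ν j * Z) → ∃ μ : MeasureTheory.Measure (Literature.Analysis.FunctionSpaces.Torus.energySpace (Fin 3)), Literature.Analysis.FluidPDE.Torus.IsStationaryStatisticalSolution 0 f μ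

/-- item stmt-AnomalousDissipation-1439 · support · rank 7 · open · by planner
why it might fail: The cellular-dodger construction is conjectural: separatrix log-singularities make the steady problem a singular nonlinear elliptic/transport system; if planar first-shell forces are in fact coercive the item is false (and crux #2 is proved with this f).
sources: ChildressKerswellGilbert2001 (doi:10.1016/s0167-2789(01)00320-7), doi:10.1007/s00220-022-04520-9, Literature.Barriers.AnomalousDissipation.Marchioro1986_globalAttraction, Literature.Analysis.FluidPDE.Torus.isStationaryStatisticalSolution_dirac, FoiasManleyRosaTemam2001 Ch. IV Remark after Def. 1.2
[support, negative calibration = card F5] The Kolmogorov force sin(2π x₁) e₀ = Torus.frameField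
(Pi.single 1 1) 0 false IS carried by a finite-enstrophy stationary statistical solution of forced
Euler, i.e. it is NOT H¹-coercive (by the scalings v ↦ λv, x ↦ mx this covers F sin(2πm x₁)e₀ for
all F > 0, m ≥ 1). Card's construction: an x₂-invariant steady cellular Euler state v = ∇⊥ψ(x₀,x₁)
with cells placed antisymmetrically w.r.t. the force so that streamline averages of curl f vanish;
vorticity = eigen-part + streamline integral of curl f, log-singular at separatrices, hence v ∈
W^{1,p} for all p < ∞ ⊂ V; Lyapunov–Schmidt/Nash–Moser around A sin(2πx₀) sin(2πx₁) with A large;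
then the Dirac measure at v is the dodger (isStationaryStatisticalSolution_dirac with ν = 0, (f,v) =
0). Consequence: crux CoerciveForceExists must use genuinely three-component forces
(CyclicForceCoercive). Its NEGATION would prove CoerciveForceExists outright with the Kolmogorov
force — either outcome is informative. Cheapest experiment: finite-Fourier-mode algebraic search for
exact steady dodgers (the two-wave ansatz k₁=(1,0,0), k₂=(−1,1,0) emits no pure first-shell mode —
planner's hand computation). -/
@[route_item "route-AnomalousDissipation-ForcedSmallScales"]
def KolmogorovForceNotCoercive : Prop :=
  ∃ μ : MeasureTheory.Measure (Literature.Analysis.FunctionSpaces.Torus.energySpace (Fin 3)), Literature.Analysis.FluidPDE.Torus.IsStationaryStatisticalSolution 0 (Literature.Analysis.FluidPDE.Torus.frameField (d := Fin 3) (Pi.single 1 1) 0 false) μ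

/-- item stmt-AnomalousDissipation-1440 · support · rank 8 · open · by planner
why it might fail: A steady or quasi-periodic finite-enstrophy forced-Euler state carrying f₁ may exist (Beltrami-pair interactions (λ₁−λ₂)P(u₁×u₂) emit first-shell modes; Nash–Moser near ABC flows); no rigidity theorem for H¹ stationary Euler statistics is available.
sources: doi:10.1016/j.aim.2021.107730, doi:10.1007/s11401-009-0092-7, arXiv:1305.7089, Literature.Analysis.FluidPDE.exists_isSmooth_isDivFree_hasZeroMean_ne_zero (frameField force pattern)
[support, explicit special case ⇒ CoerciveForceExists] The cyclic three-component first-shell force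
f₁ = sin(2πx₁)e₀ + sin(2πx₂)e₁ + sin(2πx₀)e₂ (sum of three Torus.frameField's; smooth, div-free,
mean-zero, ≠ 0, a Stokes eigenfield that is NOT Beltrami and has no invariant planar subspace: it is
the card's suggested force 'sin(2πx₂)e₁ + sin(2πx₃)e₂ + sin(2πx₁)e₃' in 0-indexed coordinates)
admits no stationary statistical solution of forced Euler. Proving it proves crux #2 (glue:
isSmooth_realTrigPoly, isDivFree_frameField, integral_frameField, sums). Refuting it (one
finite-enstrophy dodger for f₁ — e.g. a converged Newton search for a finite-mode steady state, then
certified) redirects #2 to other forces (detuned ABC-type forces off the Beltrami locus) without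
breaking the route. -/
@[route_item "route-AnomalousDissipation-ForcedSmallScales"]
def CyclicForceCoercive : Prop :=
  ∀ μ : MeasureTheory.Measure (Literature.Analysis.FunctionSpaces.Torus.energySpace (Fin 3)), ¬ Literature.Analysis.FluidPDE.Torus.IsStationaryStatisticalSolution 0 (Literature.Analysis.FluidPDE.Torus.frameField (d := Fin 3) (Pi.single 1 1) 0 false + Literature.Analysis.FluidPDE.Torus.frameField (d := Fin 3) (Pi.single 2 1) 1 false + Literature.Analysis.FluidPDE.Torus.frameField (d := Fin 3) (Pi.single 0 1) 2 false) μ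

/-- item stmt-AnomalousDissipation-14141 · support · rank 9 · open · by planner
sources: route items CoerciveForceExists, BoundedFamilyOfCoercive, RateRigidity, ForcedSmallScalesThesis (Theses/ForcedSmallScales.lean), planner Sketch.lean (rc 0, 2026-08-16)
[support, glue → target; pure logic, provable now in two Lean lines] The three cruxes imply Thesis X
(item ForcedSmallScalesThesis): take the coercive force f (smooth, div-free, mean-zero, f ≠ 0, no
stationary statistical solution of forced Euler) from CoerciveForceExists; clause (C2) of X is
BoundedFamilyOfCoercive instantiated at f, clause (C3) is RateRigidity instantiated at f
(RateRigidity does not take f ≠ 0). Checked proof (planner's Sketch.lean, rc 0): `rintro ⟨f, hs, hd,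
hm, hne, hco⟩ hB hR; exact ⟨f, hs, hd, hm, hne, hco, hB f hs hd hm hne hco, hR f hs hd hm hco⟩`.
Filed by the route-repair planner (2026-08-16) to make the target reachable in the obligation graph
(gate stamp route.target-unreachable); it carries no mathematics and does not change the deciding
theorem `closes` (EnstrophyDichotomy → CoerciveForceExists → BoundedFamilyOfCoercive → RateRigidity
→ Assembly → AnomalousDissipation, native OK). [deps: CoerciveForceExists, BoundedFamilyOfCoercive,
RateRigidity, ForcedSmallScalesThesis] [difficulty: S] -/
@[route_item "route-AnomalousDissipation-ForcedSmallScales"]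
def ThesisOfCruxes : Prop :=
  CoerciveForceExists → BoundedFamilyOfCoercive → RateRigidity → ForcedSmallScalesThesis

/-- item stmt-AnomalousDissipation-1441 · assembly · rank 1 · open · by planner
sources: Literature.Turb.ZerothLaw (Summits/AnomalousDissipation/AnomalousDissipation/Statement.lean), Literature.Analysis.FluidPDE.meanEnergy_eq_longTimeAvgSup, Literature.Analysis.FluidPDE.Torus.integral_norm_sq_eq_norm_lift_sq
[assembly] EnstrophyDichotomy → CoerciveForceExists → BoundedFamilyOfCoercive → RateRigidity →
AnomalousDissipation. Bookkeeping (~150 lines): take f from CoerciveForceExists and (ν, u₀, u, U, E)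
from BoundedFamilyOfCoercive. Claim Tendsto (j ↦ meanDissipation (ν j) (u j) / ν j) atTop atTop:
otherwise ∃ Z, ∃ᶠ j, quotient ≤ Z; extract φ strictly monotone
(Filter.extraction_of_frequently_atTop); the subfamily (ν ∘ φ, u₀ ∘ φ, u ∘ φ, U ∘ φ) satisfies all
hypotheses of EnstrophyDichotomy with meanDissipation ≤ ν Z (ν > 0), which yields μ with
Torus.IsStationaryStatisticalSolution 0 f μ — contradicting coercivity. RateRigidity then gives ε >
0 and N with ε ≤ meanDissipation (ν j) (u j) for j ≥ N. Witness for Literature.Turb.ZerothLaw: f, ν'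
j = ν (j+N), u₀' j = u₀ (j+N), u' j = u (j+N): positivity and Tendsto (tendsto_add_atTop_iff_nat)
are inherited; meanEnergy (u' j) = limsup of Cesàro means of t ↦ ∫‖u t x‖² = ‖U t‖² on t ≥ 0
(integral_norm_sq_eq_norm_lift_sq) with values in [0,E], so the Real limsup is ≤ E (cobounded below
by 0; non-integrable slices only give the junk mean 0 ≤ E); the dissipation clause is the eventual
bound. Unfold AnomalousDissipation = Literature.Turb.ZerothLaw. -/
@[route_item "route-AnomalousDissipation-ForcedSmallScales", crux]
def Assembly : Prop :=
  EnstrophyDichotomy → CoerciveForceExists → BoundedFamilyOfCoercive → RateRigidity → AnomalousDissipation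

/-! D-0027 §2.1 — DECIDING THEOREM (planner-authored via `route open/edit --closes-file`; by planner-rrepair-AnomalousDissipation-ForcedSma-3b00b3da-g2-0 2026-08-15T16:12:43Z):
its hypotheses are this route's items and its conclusion the sub-problem Statement (glue_lint), and it elaborates with this file. -/

@[closes "route-AnomalousDissipation-ForcedSmallScales"] theorem closes (h_EnstrophyDichotomy : EnstrophyDichotomy) (h_CoerciveForceExists : CoerciveForceExists) (h_BoundedFamilyOfCoercive : BoundedFamilyOfCoercive) (h_RateRigidity : RateRigidity) (h_Assembly : Assembly) : _root_.AnomalousDissipation :=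
  h_Assembly h_EnstrophyDichotomy h_CoerciveForceExists h_BoundedFamilyOfCoercive h_RateRigidity

end Summit.AnomalousDissipation.AnomalousDissipation.Theses.ForcedSmallScales
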